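import Summits.BirchSwinnertonDyer.BirchSwinnertonDyer.Theses.SemiOrdinaryEisensteinDescent
import Summits.BirchSwinnertonDyer.BirchSwinnertonDyer.Theorems.WildThreeRankOneBSDpOfExactIndexManin
import Summits.BirchSwinnertonDyer.BirchSwinnertonDyer.Theorems.SchneiderFreeAdditiveX3UpperReceptacle
import Summits.BirchSwinnertonDyer.BirchSwinnertonDyer.Theorems.ClassRecordThreeStepLOfHalvesB
import Literature.NumberTheory.EllipticCurves.BSDHeegnerPointsGrossZagierProofs
import Literature.NumberTheory.EllipticCurves.KrizLi2019.SexticTwistBSDThreeDescent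
import Literature.NumberTheory.EllipticCurves.GlobalMinimalModelProofs
import Literature.NumberTheory.EllipticCurves.ModularCurveManinConstantProofs
import HarnessLib

/-!
# Route `SemiOrdinaryEisensteinDescent`, support item `EisensteinKernelAtThree`
# (stmt-BirchSwinnertonDyer-20485): THE KERNEL — published inputs → Eisenstein inclusion → Kolyvagin
# upper bound → Waldspurger unit value → control → rank-zero twist → non-tower residual ⟹ the leaf
# `WAllExclAddWildRankOneSurj`, PROVED (Jetchev–Skinner–Wan §7.4 at the wild split prime `3`,
# Manin-robust, ONE-SIDED halves)

Cell `bsd-wall` (W-ALL, lane 3), prover seat `bsd-wall-bed-p3` (gen 1), 2026-08-27, on the route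
author's proof plan (planner bsd-wall-pss3 g4; item text: «= `Theorems/UniversalToricDescentToricKernelAtThree.lean`
ll. 92–197 with two substitutions»). Closes the support item `EisensteinKernelAtThree` of route
`route-BirchSwinnertonDyer-SemiOrdinaryEisensteinDescent` (rev 2): the theorem below has LITERALLY the
type `Summit.BirchSwinnertonDyer.BirchSwinnertonDyer.Theses.SemiOrdinaryEisensteinDescent.EisensteinKernelAtThree`.

## The assembly (every step a tree theorem; the cruxes enter as the item's antecedents)

For `E/ℚ` (globally minimal `W`), non-CM, on the wild class `ClassO6 W 3` with `ρ̄_{E,3}` onto and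
`r_an(E) = 1`:

* (o) TOWER SPLIT. If the `3`-adic tower `ρ_{E,3^n}` is not surjective for some `n`, the residual crux
  `WildRankOneSurjNonTowerAtThree` pays `BSD₃(E)` by name. Otherwise (`TowerSurjThree W`):
* (a) DATA. Parity (`r_an` odd ⟹ `w(E) = −1`) and Friedberg–Hoffstein Thm. B with the auxiliary modulus
  `M = 2` give an imaginary quadratic `K` with the Heegner hypothesis for `N(E)` AND `2` split — so
  `d_K ≡ 1 (mod 8)` is ODD — and `L(E^{d_K},1) ≠ 0`; `3 ∣ N(E)` (additive) splits, so `3 ∤ d_K` and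
  `d_K ≠ −3`; `exists_isHeegnerPoint` gives `(Dt, H, ι, P)`, Gross–Zagier makes `P` non-torsion,
  Kolyvagin gives `rank E(K) = 1` and `Ш(E/K)` finite. A frame: the anticyclotomic `κ` with generator
  `γ`, a degree-one `𝔭 ∋ 3` and THE OTHER degree-one prime `𝔭′ ≠ 𝔭`.
* (b) PLUMBING. `WildSplitWaldspurgerAtThree` at `(κ, γ, 𝔭)`: `ι′` inducing `𝔭`, a BDP frame
  `L ∈ R₀⟦T⟧` for `Dt.f`, and `L(𝟙) = u·(log_𝔭 P / c)²` with `u ∈ R₀ˣ`. `WildSplitControlAtThree` at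
  `𝔭′` gives the control count (`X_(∅,0)` at `𝔭′` torsion, `Ch = (f)`, `ord f(0) = n`, and the count
  `n`). The EISENSTEIN crux `WildSplitEisensteinInclusionAtThree` at `(κ, γ, 𝔭, 𝔭′, ι′, L)` — torsion
  guard discharged by the control — gives `Ch_Λ(X_(∅,0))·R₀⟦T⟧ ⊆ (L)`; the lower norm receptacle
  (`Supersingular.two_mul_valuation_le_of_mem_span`, with the value moved to `log_{𝔭′}` by K1's
  `hasValueAt_sq_logOmega_embAt_iff_of_rank_one`) reads it as the LOWER socket at slack `v₃(c)`, and
  K1's link `indexLowerBoundLeAt_of_imcLowerLe_of_control` as `IndexLowerBoundLeAt W 3 K P (v₃ c)`.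
  The UPPER socket `Upper.IndexUpperBoundLeAt W 3 K P (v₃ c)` IS the Kolyvagin crux
  `WildKolyvaginUpperAtThree` (tower surjectivity from (o), `d_K` odd and `≠ −3` from (a)).
* (c) TERMINAL STEP = p528981 `SchneiderFree.Exact.bsdp_three_of_exactIndexManin_of_wAllExclAddWildRankZero`:
  the rank-zero wild leaf (`WildRankZeroTwistAtThree = WAllExclAddWildRankZero`, an antecedent) pays
  `BSD₃` of a minimal model of `E^{d_K}`, and the exact index descends to `BSD₃(E)`.

HONEST FRAMING: this closes a SUPPORT item (pure assembly); every crux of the route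
(`WildSplitEisensteinInclusionAtThree`, `WildKolyvaginUpperAtThree`, `WildSplitWaldspurgerAtThree`,
`WildSplitControlAtThree`, `WildRankZeroTwistAtThree`, `WildRankOneSurjNonTowerAtThree`) and the
published inputs are ANTECEDENTS of the statement proved; BSD is not proved for any curve by this
file. No definition, no named fact, no `sorry`. The route is in status `draft` (tribunal pending) at
the time of writing; the kernel refers to the cruxes BY NAME, so a re-wording of a crux text that
keeps its name leaves the STATEMENT proved here unchanged (the proof may need the same edit).

References: [JetchevSkinnerWan2017] §7.4.1 (arXiv:1512.06894 p. 30); [Castella2018] Thm. 2.3, §5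
(5.1)–(5.3); [GrossZagier1986] Thm. I.(6.3), V.§2; [FriedbergHoffstein1995] Thm. B; [Gross1991] (1.1),
Thm. 1.3; [Jetchev2008] Thm. 1.4.
-/

noncomputable section

open scoped Classical

set_option linter.dupNamespace false
set_option autoImplicit false

namespace Summit.BirchSwinnertonDyer.BirchSwinnertonDyer.Theorems

open WeierstrassCurve NumberField IsDedekindDomain Field
  Literature.NumberTheory.EllipticCurves
  Literature.NumberTheory.EllipticCurves.ModularForms
  Literature.NumberTheory.EllipticCurves.Rank1Residual
  Literature.NumberTheory.EllipticCurves.KrizLi2019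
  Summit.BirchSwinnertonDyer.Rank1Residual
  Summit.BirchSwinnertonDyer.Rank1Residual.Additive
  Summit.BirchSwinnertonDyer.Rank1Residual.X11b
  Summit.BirchSwinnertonDyer.Rank1Residual.X11b.AcSelmer
  Summit.BirchSwinnertonDyer.Rank1Residual.X11b.Halves
  Summit.BirchSwinnertonDyer.BirchSwinnertonDyer.Theses.SemiOrdinaryEisensteinDescent

/-- **Item `EisensteinKernelAtThree` (stmt-BirchSwinnertonDyer-20485) of route
`SemiOrdinaryEisensteinDescent` holds**: published inputs → `WildSplitEisensteinInclusionAtThree` →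
`WildKolyvaginUpperAtThree` → `WildSplitWaldspurgerAtThree` → `WildSplitControlAtThree` →
`WildRankZeroTwistAtThree` → `WildRankOneSurjNonTowerAtThree` ⟹ `WAllExclAddWildRankOneSurj`
(`BSD₃(E)` for every globally minimal non-CM `E/ℚ` on `ClassO6 W 3` with `ρ̄_{E,3}` onto and
`r_an = 1`). Jetchev–Skinner–Wan's §7.4 assembly at the wild split prime `3` with the Manin constant
kept on both sides and ONE-SIDED halves: off the `3`-adic tower-surjective rows the residual crux; on
them Friedberg–Hoffstein field (`2` and all of `N(E)` split), Heegner point, Gross–Zagier, Kolyvagin,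
frame `(κ, γ, 𝔭, 𝔭′)`, Waldspurger value at `𝔭`, control at `𝔭′` (torsion guard), Eisenstein
inclusion `⊆` at the frame ⟹ lower socket, Kolyvagin crux ⟹ upper socket, both at slack `v₃(c)` ⟹
p528981. [cite: JetchevSkinnerWan2017, §7.4.1 (arXiv:1512.06894 p. 30)]
[cite: Castella2018, Thm. 2.3 and §5 (5.1)–(5.3)] [cite: GrossZagier1986, Thm. I.(6.3) and V.§2]
[cite: FriedbergHoffstein1995, Thm. B] -/
theorem semiOrdinaryEisensteinDescent_eisensteinKernelAtThree_proof : EisensteinKernelAtThree := by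
  unfold EisensteinKernelAtThree Summit.BirchSwinnertonDyer.WAllExclAddWildRankOneSurj
  intro hF hE hKoly hV hC hZ hNT W _ _ hncm hO6 hsurj hr
  -- (o) TOWER SPLIT: off the tower-surjective rows the residual crux pays by name
  by_cases htower : AdditiveThree.TowerSurjThree W
  swap
  · exact hNT W hncm hO6 hsurj htower hr
  obtain ⟨hGZ, hKo, hGZK, hmod, hmodP, -, hGZ73, hFH, hpar, hHP⟩ := hF
  haveI hN0 : NeZero (W.conductorNorm ℤ) := ⟨W.conductorNorm_pos_holds.ne'⟩
  -- (a) DATA. parity: `r_an = 1` is odd, so `w(E) = -1`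
  have hw : W.rootNumber = -1 := by
    rcases W.rootNumber_eq_one_or with h | h
    · exfalso
      have heven : Even W.analyticRank := (hpar W).mpr h
      rw [hr] at heven
      exact Nat.not_even_one heven
    · exact h
  -- Friedberg–Hoffstein with auxiliary modulus `2`: Heegner for `N(E)` and `2` split
  obtain ⟨K, _, _, hK, -, hHN, hH2, hLt⟩ := hFH W hw 2 two_ne_zero 0
  have hodd : Odd (NumberField.discr K) := by
    have h8 := Literature.SatisfiesHeegnerHypothesis.discr_emod_eight hK.1 hH2 (dvd_refl 2)
    rw [Int.odd_iff]; omega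
  -- `3 ∣ N(E)` (additive) splits in `K`; hence `3 ∤ d_K`, `d_K ≠ -3`
  have h3N : 3 ∣ W.conductorNorm ℤ :=
    (W.dvd_conductorNorm_iff_not_hasGoodReductionAtPrime 3).mpr (not_good_of_addv W 3 hO6.2.1)
  have hsplit : SplitsIn K 3 := hHN 3 Nat.prime_three h3N
  have hd3 : NumberField.discr K ≠ -3 := by
    intro h
    exact Literature.SatisfiesHeegnerHypothesis.not_dvd_discr hK.1 hHN Nat.prime_three h3N
      (by rw [h]; norm_num)
  -- the Heegner point over `K` and its data; non-torsion by Gross–Zagier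
  obtain ⟨P, Dt, H, ι, hP⟩ := hHP W K hK hHN
  have hL0 : W.entireLFunction 1 = 0 := entireLFunction_one_eq_zero_of_analyticRank_eq_one hr
  obtain ⟨-, hderiv⟩ := leadingLCoeff_eq_deriv_of_analyticRank_eq_one hr
  have hLK : LDerivEK W K ≠ 0 := by
    rw [lDerivEK_eq_deriv_mul W K hmod hL0]; exact mul_ne_zero hderiv hLt
  have hnt : ¬ IsOfFinAddOrder P :=
    (lDerivEK_ne_zero_iff_not_isOfFinAddOrder W (W.conductorNorm ℤ) K (hGZ _ W K) hK hHN
      ⟨Dt, H, ι, hP⟩).mp hLK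
  -- Kolyvagin: `rank E(K) = 1`, `Ш(E/K)` finite
  obtain ⟨hrk, hfin⟩ := hKo (W.conductorNorm ℤ) W K hK hHN ⟨Dt, H, ι, hP⟩ hnt
  -- a frame `(κ, γ, 𝔭)` and the other prime `𝔭′ ≠ 𝔭` above `3`
  obtain ⟨κ, γ, -, hκ, hγ, -⟩ := X11b.exists_anticyclotomic_generator_prime (p := 3) hK
  haveI : Fact (κ.IsTopGenerator γ) := ⟨hγ⟩
  obtain ⟨𝔭, h𝔭, he, hf⟩ := X11b.exists_degreeOnePrime_of_splitsIn K 3 hK.1 hsplit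
  obtain ⟨𝔭', hne, h𝔭', he', hf'⟩ := X11b.Three.exists_ne_degreeOne_prime hK.1 h𝔭 he hf
  -- (b) PLUMBING. Waldspurger frame and unit value at `(κ, γ, 𝔭)`
  obtain ⟨ι', hind, ΩK, Ωp, L, hΩK, hΩp, hBDP, u, hval⟩ :=
    hV W (W.conductorNorm ℤ) K Dt H ι P hO6 hsurj hr rfl hK hHN hLt hP hnt κ hκ γ 𝔭 h𝔭 he hf
  -- control count at `𝔭′` (CTL₀ included; supplies the torsion guard of the Eisenstein crux)
  have hctl : SchneiderFree.AdditiveControlOnTreeAt 3 κ 𝔭' γ (embAt K 3 𝔭' h𝔭' he' hf') P :=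
    hC W (W.conductorNorm ℤ) K Dt H ι P hO6 hsurj hr rfl hK hHN hLt hP hnt (hKo _ W K) κ hκ γ 𝔭'
      h𝔭' he' hf'
  obtain ⟨n, hn, hneq⟩ := hctl
  -- the EISENSTEIN INCLUSION `Ch_Λ(X_(∅,0))·R₀⟦T⟧ ⊆ (L)` at the frame (the crux, torsion-guarded)
  have hincl : (XAc.charIdeal (W.baseChange K) 3 κ 𝔭' ∅ γ).map (PowerSeries.map (toUnr 3)) ≤
      Ideal.span {L} :=
    hE W (W.conductorNorm ℤ) K Dt hO6 hsurj hr rfl hK hHN κ hκ γ 𝔭 h𝔭 he hf 𝔭' h𝔭' hne ι' hind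
      ΩK Ωp L hΩK hΩp hBDP hn.1
  -- the value read through the logarithm at `𝔭′` (rank one: `(log_{𝔭′} P)² = (log_𝔭 P)²`)
  have hval' : L.HasValueAt 0 ((((u : unrIntegers 3) : unrIntegers 3) : ℂ_[3]) *
      (algebraMap ℚ_[3] ℂ_[3]
        (logOmega W 3 (embAt K 3 𝔭' h𝔭' he' hf') P / (Dt.c : ℚ_[3]))) ^ 2) :=
    (SchneiderFreeAdditiveX3.hasValueAt_sq_logOmega_embAt_iff_of_rank_one W 3 hK.1 hrk h𝔭 he hf
      h𝔭' he' hf' P _ _ L).mpr hval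
  -- the LOWER socket at slack `v₃(c)` at the frame `(κ, 𝔭′, γ, embAt 𝔭′)`
  have hc0 : Dt.c ≠ 0 := Dt.maninConstant_ne_zero_holds
  have hlog : logOmega W 3 (embAt K 3 𝔭' h𝔭' he' hf') P ≠ 0 := X11b.R1.logOmega_ne_zero W 3 _ hnt
  have hlow : SchneiderFree.AdditiveIMCLowerBDPOnTreeLeAt 3 κ 𝔭' γ (embAt K 3 𝔭' h𝔭' he' hf')
      (padicValNat 3 Dt.c.natAbs) P := by
    -- the LOWER norm receptacle (`⊆` + value): `2·ord₃(log_{𝔭′}P / c) ≤ ord₃ f(0)`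
    obtain ⟨htors, f, hfI, hf0, hfn⟩ := hn
    have hmem : PowerSeries.map (toUnr 3) f ∈ Ideal.span {L} := by
      have h3 := hincl
      rw [hfI, CongruenceLimit.map_span_singleton_powerSeries] at h3
      exact (Ideal.span_singleton_le_iff_mem _).mp h3
    obtain ⟨-, hle⟩ := Supersingular.two_mul_valuation_le_of_mem_span 3 hf0 hmem u hval'
    have hc0' : (Dt.c : ℚ_[3]) ≠ 0 := by exact_mod_cast hc0
    rw [div_eq_mul_inv, Padic.valuation_mul hlog (inv_ne_zero hc0'), Padic.valuation_inv,
      Padic.valuation_intCast, valuation_logOmega hlog, hfn] at hle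
    refine ⟨n, ⟨htors, f, hfI, hf0, hfn⟩, ?_⟩
    simp only [padicValInt] at hle
    linarith
  have hlo : SchneiderFree.IndexLowerBoundLeAt W 3 K P (padicValNat 3 Dt.c.natAbs) :=
    SchneiderFreeAdditiveX3.indexLowerBoundLeAt_of_imcLowerLe_of_control rfl hK hHN hfin hlow
      ⟨n, hn, hneq⟩
  -- the UPPER socket at slack `v₃(c)` IS the Kolyvagin crux (tower surjectivity, `d_K` odd, `≠ -3`)
  have hupI : SchneiderFree.Upper.IndexUpperBoundLeAt W 3 K P (padicValNat 3 Dt.c.natAbs) :=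
    hKoly W (W.conductorNorm ℤ) K Dt H ι P hO6 hsurj hr rfl hK hHN hLt hP hnt hodd hd3 htower
  -- (c) TERMINAL STEP: a globally minimal model of the twist, then p528981
  have hD0 : (NumberField.discr K : ℚ) ≠ 0 := by exact_mod_cast NumberField.discr_ne_zero K
  haveI : (W.quadraticTwist (NumberField.discr K : ℚ)).IsElliptic := W.isElliptic_quadraticTwist hD0
  obtain ⟨Cd, hCd⟩ := hasGlobalMinimalModel_rat_holds (W.quadraticTwist (NumberField.discr K : ℚ))
  haveI : (Cd • W.quadraticTwist (NumberField.discr K : ℚ)).IsGloballyMinimal := hCd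
  exact SchneiderFree.Exact.bsdp_three_of_exactIndexManin_of_wAllExclAddWildRankZero hGZ hKo hGZK hmod
    hGZ73 hZ W hO6 hsurj hr (W.conductorNorm ℤ) K Dt H ι P
    (Cd • W.quadraticTwist (NumberField.discr K : ℚ)) rfl hK hodd hHN hLt hP ⟨Cd, rfl⟩ hlo hupI

end Summit.BirchSwinnertonDyer.BirchSwinnertonDyer.Theorems

end
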